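import Literature.NumberTheory.Automorphic.AutomorphicFormsStableHolds
import HarnessLib

/-!
# Borel–Jacquet 4.3 — the corrected named fact (involution `ℝ`-linear), discharged

Topic `NumberTheory/Automorphic`; sibling file of `AutomorphicForms` on the named fact
`automorphicForms_isStableSubmodule 𝒟` (Borel–Jacquet 1979, 4.3: the space `𝒜` of automorphic
forms of a regular automorphy datum is a `(𝔤, K_∞) × G(𝔸_f)`-module).

## Why this file exists (verdict `misstated` on `automorphicForms_isStableSubmodule`)

The fact as vendored in `AutomorphicForms` reads
`∀ [FiniteDimensional ℝ A] (h𝒟 : 𝒟.IsRegular), IsStableSubmodule 𝒟 (automorphicForms 𝒟)` for an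
automorphy datum `𝒟` over an ARBITRARY commutative real Banach `*`-algebra `A` — the section binder
is a bare `[StarRing A]`, so the involution of `A` is not required to be `ℝ`-linear (nor continuous).
In the source (Borel–Jacquet 1979, §4.1) the coefficient algebra is `K ⊗_ℚ ℝ ≅ ℝ^{r₁} × ℂ^{r₂}`
with its standard involution, which IS `ℝ`-linear; and every published proof of 4.3 (ii) — Harish-
Chandra's `φ = φ ∗ α` (HC 1966, §8, Lemma 13; Borel 1997, 2.14/5.6) as well as the elliptic-regularity
proof formalised in `AutomorphicFormsStableHolds` — uses that `K_∞ = G_∞ ∩ U(N, A)` is compact and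
that `𝔨 = 𝔤 ∩ 𝔲(N, A)` is a real subspace, i.e. `[StarModule ℝ A]`. The regularity hypotheses
(`AutomorphyDatum.IsRegular`: `IsStarFormallyReal A`, global Cartan decomposition, …) do NOT imply
it: `exists_starRing_isStarFormallyReal_not_starModule` (`RealMatrixGroupsWildStar`) exhibits a
star-formally-real involution of `ℂ` (complex conjugation conjugated by a wild automorphism) that is
not `ℝ`-linear; for such coefficient involutions `K_∞` is neither closed nor bounded and no argument,
published or formal, applies. So the hypothesis `[StarModule ℝ A]` is missing from the FORMAL
statement, not from Borel–Jacquet, and the vendored fact is recorded as mis-stated.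

Following the provefact protocol for a mis-stated fact, this file vendors the corrected statement
under a new name, with the same citation, and discharges it:

* `automorphicForms_isStableSubmodule_starModule : Prop` — BJ 4.3 with the involution `ℝ`-linear, as ONE
  closed statement over all data: `∀ … (𝒟 : AutomorphyDatum 𝒢 A N) [FiniteDimensional ℝ A] [StarModule ℝ A],
  𝒟.IsRegular → IsStableSubmodule 𝒟 (automorphicForms 𝒟)`;
* `automorphicForms_isStableSubmodule_starModule_holds` — its discharge, a one-liner on
  `isStableSubmodule_automorphicForms_of_isRegular` (`AutomorphicFormsStableHolds`, proved from the
  elliptic annihilator of `AutomorphicFormsEllipticAnnihilator`, the exponential charts of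
  `ArchimedeanExpChart` and Nelson's `L²` interior estimate);
* under `[StarModule ℝ A]` the corrected fact gives back the vendored one for every datum — that bridge
  is already in the tree as `automorphicForms_isStableSubmodule_holds_of_starModule`
  (`AutomorphicFormsStableHolds`; not restated here), so the two statements agree on every coefficient
  algebra of the source's kind and a dependent `(h : automorphicForms_isStableSubmodule 𝒟)` over such an
  `A` — e.g. `mixedSpace K`, cf. `automorphicForms_isStableSubmodule_gl`, `AutomorphicFormsStableGLHolds` —
  is fed that term.

The old `def automorphicForms_isStableSubmodule` is left untouched here (its ~10 importers destructure
its binder); restating it in place is the business of the file's restatement unit.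

## References

* A. Borel, H. Jacquet, *Automorphic forms and automorphic representations*, Proc. Sympos. Pure
  Math. 33 (Corvallis 1977), Part 1 (1979), 189–202, §4.1 (the coefficient algebra `K ⊗_ℚ ℝ`) and
  4.3 [BorelJacquet1979].
* Harish-Chandra, *Discrete series for semisimple Lie groups II*, Acta Math. 116 (1966), §8,
  Lemma 13 [HarishChandra1966].
* A. Borel, *Automorphic forms on `SL₂(ℝ)`*, Cambridge Tracts in Math. 130 (1997), 2.14, 5.6 [Borel1997].
-/

noncomputable section

namespace Literature.NumberTheory.Automorphic

universe w u v

/-- **Borel–Jacquet 1979, 4.3 — corrected statement** (a closed named fact). For every regular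
automorphy datum `𝒟` over a finite-dimensional commutative real Banach `*`-algebra `A` whose
involution is `ℝ`-linear (`[StarModule ℝ A]`; in the source `A = K ⊗_ℚ ℝ ≅ ℝ^{r₁} × ℂ^{r₂}` with its
standard involution, §4.1), the space of automorphic forms is stable under right translation by
`G(𝔸_f)` and by `K_∞` and under the Lie derivatives `X φ`, `X ∈ 𝔤` — so it is a
`(𝔤, K_∞) × G(𝔸_f)`-module. This corrects the named fact `automorphicForms_isStableSubmodule 𝒟` of
`AutomorphicForms`, whose binder omits `[StarModule ℝ A]` — a standing hypothesis of the source's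
setting that `AutomorphyDatum.IsRegular` does not imply
(`exists_starRing_isStarFormallyReal_not_starModule`, `RealMatrixGroupsWildStar`); on coefficient
algebras with `ℝ`-linear involution the two agree (the vendored fact then holds for every datum:
`automorphicForms_isStableSubmodule_holds_of_starModule`, `AutomorphicFormsStableHolds`).
Borel–Jacquet 1979, 4.3 (using §1.2, §1.5–1.6 and Harish-Chandra's lemma `φ = φ ∗ α`, HC 1966, §8,
Lemma 13). [cite: BorelJacquet1979, 4.3] -/
def automorphicForms_isStableSubmodule_starModule : Prop :=
  ∀ {K : Type} [Field K] [NumberField K] {𝒢 : AdelicGroupData.{w} K}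
    {A : Type u} [NormedCommRing A] [NormedAlgebra ℝ A] [NormedAlgebra ℚ A] [CompleteSpace A]
    [StarRing A] {N : Type v} [Fintype N] [DecidableEq N] (𝒟 : AutomorphyDatum 𝒢 A N)
    [FiniteDimensional ℝ A] [StarModule ℝ A], 𝒟.IsRegular → IsStableSubmodule 𝒟 (automorphicForms 𝒟)

/-- **Borel–Jacquet 1979, 4.3 (corrected statement) holds**: discharge of
`automorphicForms_isStableSubmodule_starModule` by `isStableSubmodule_automorphicForms_of_isRegular`
(`AutomorphicFormsStableHolds`: the group and `𝔨` parts are formal, the moderate growth of `X φ` is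
interior elliptic regularity on the elliptic annihilator of a `K_∞`-finite `Z(𝔤)`-finite form of
moderate growth). Borel–Jacquet 1979, 4.3; Harish-Chandra 1966, §8, Lemma 13. [cite: BorelJacquet1979, 4.3] -/
theorem automorphicForms_isStableSubmodule_starModule_holds : automorphicForms_isStableSubmodule_starModule := by
  intro K _ _ 𝒢 A _ _ _ _ _ N _ _ 𝒟 _ _ h𝒟
  exact isStableSubmodule_automorphicForms_of_isRegular h𝒟

end Literature.NumberTheory.Automorphic
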